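import Summits.CriticalPhenomena.PercolationContinuityZ3.Theorems.Transplant.CayleyClassTwoUnitRange
import Summits.CriticalPhenomena.PercolationContinuityZ3.Theorems.Transplant.CayleySkeletonFrm
import HarnessLib

/-!
# Class 2 with ANY unit-range alphabet and NO automorphism, modulo N2; monotonicity of the connected-cylinder criterion in the alphabet

builds on p205010 (kernel theorem, internal audit signed; external expert review pending) — nothing in this file uses p205010; the frames-only node
`SamePDropOfSkeletonFrm₁` is an OPEN `Prop` of this programme, taken as a HYPOTHESIS (`hN`); nothing is claimed about it.  Lane `prim-bschramm`,
seat `prim-bschramm-p4` gen 13 (PART C3 of `P4-GENERAL.md` §35.7).  Helper file (`--supports stmt-CriticalPhenomena-4575 --as helper`).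

* `CayleyFrm₂.ofClassTwo`: the frames-only Cayley datum for a group of class `≤ 2` and ANY symmetric generating `S` carrying a unit-range additive
  chart with unit steps (`CylBase.boxWalks_of_classTwo`, file `CayleyClassTwoUnitRange`) — NO automorphism; **`theta_eq_zero_of_le_classTwo_of_frmNode₁`:
  θ_g(p) = 0 ∀ p ≤ p_c on `Cay(Γ; S)` modulo N2**.
* `CayleyFrm₂.ofSuperset`: MONOTONICITY — adding unit-range generators keeps the unit cylinder connected (same vertex set, more edges), so every
  connected-cylinder criterion of the lineage (`ofKerLetters`, `ofClassThree`, `ofClassTwo`, `CayleyNeg₂`) extends to supersets `S' ⊇ S` with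
  `‖φ(S')‖_∞ ≤ 1` (extra diagonal / doubled letters).
[cite: BenjaminiSchramm1996, Conj. 4; §2 (Cayley graphs)] [cite: KozmaNitzan2024, §4 p. 16 (Lemma 8)]
-/

noncomputable section

namespace Summit.CriticalPhenomena.PercolationContinuityZ3.Theorems.Transplant

open SimpleGraph Walk Subgroup Literature.Probability.LatticeModels Literature.Probability.Percolation
open scoped Classical commutatorElement

section Customers

open CayCyl

variable {Γ : Type} [Group Γ] {S : Finset Γ}

/-- **`CayleyFrm₂` IN CLASS 2 FROM ANY UNIT-RANGE ALPHABET, NO automorphism** (`C_1` connected by `boxWalks_of_classTwo`).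
[cite: KozmaNitzan2024, §4 p. 16 (Lemma 8)] -/
def CayleyFrm₂.ofClassTwo (B : CylBase Γ S) (h2 : (⊤ : Subgroup Γ).lowerCentralSeries 2 = ⊥) (hS : Subgroup.closure (S : Set Γ) = ⊤)
    (hsymm : ∀ s ∈ S, s⁻¹ ∈ S) : CayleyFrm₂ Γ S :=
  B.toFrm₂ (B.boxWalks_of_classTwo h2 hS hsymm)

/-- **THEOREM (class 2, ANY unit-range alphabet, NO symmetry, modulo N2): `θ_g(p) = 0` for every `p ≤ p_c` on `Cay(Γ; S)`** for every group of
class `≤ 2` and every symmetric generating `S` carrying a unit-range additive chart with unit steps. [cite: BenjaminiSchramm1996, Conj. 4; §2] -/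
theorem theta_eq_zero_of_le_classTwo_of_frmNode₁ (hN : SamePDropOfSkeletonFrm₁) (B : CylBase Γ S)
    (h2 : (⊤ : Subgroup Γ).lowerCentralSeries 2 = ⊥) (hS : Subgroup.closure (S : Set Γ) = ⊤) (hsymm : ∀ s ∈ S, s⁻¹ ∈ S) (g : Γ)
    {p : unitInterval} (hp : (p : ℝ) ≤ criticalProb (mulCayley (↑S : Set Γ)) g) : theta (mulCayley (↑S : Set Γ)) g p = 0 :=
  (CayleyFrm₂.ofClassTwo B h2 hS hsymm).theta_eq_zero_of_le_of_frmNode₁ hN g hp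

/-- **MONOTONICITY IN THE ALPHABET**: adding unit-range generators keeps the unit cylinder connected (same vertex set, more edges), so a
`CayleyFrm₂` on `S` gives one on every `S' ⊇ S` with `‖φ(S')‖_∞ ≤ 1`. [folklore] -/
def CayleyFrm₂.ofSuperset (C : CayleyFrm₂ Γ S) {S' : Finset Γ} (hsub : S ⊆ S') (lip' : ∀ s ∈ S', ∀ i : Fin 2, |C.φ s i| ≤ 1) :
    CayleyFrm₂ Γ S' where
  φ := C.φ
  map_mul := C.map_mul
  lip := lip'
  step := fun i => by obtain ⟨s, hs, h⟩ := C.step i; exact ⟨s, hsub hs, h⟩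
  cyl_one := by
    have hle : (mulCayley (S : Set Γ)).induce {g | C.φ g ∈ box 2 1} ≤ (mulCayley (S' : Set Γ)).induce {g | C.φ g ∈ box 2 1} :=
      fun _ _ h => mulCayley_mono (Finset.coe_subset.2 hsub) h
    exact C.cyl_one.mono hle

end Customers

end Summit.CriticalPhenomena.PercolationContinuityZ3.Theorems.Transplant

end
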